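import Literature.AlgebraicGeometry.Motives.UniversalHyperplaneSectionChart
import Literature.AlgebraicGeometry.Motives.HyperplaneSectionChartAlgebra
import Literature.AlgebraicGeometry.Smoothening.JacobianCriterionFibre
import Literature.AlgebraicGeometry.Motives.ProjectiveSpaceCells
import HarnessLib

/-!
# The universal hyperplane section is smooth over `(ℙᴺ)^*` near every smooth fibre

Topic `Literature/AlgebraicGeometry/Motives` (definitions + theorems, no named facts). For a closed
(more generally affine) immersion `ι : X ⟶ ℙᴺ_k` of a smooth `k`-scheme of relative dimension `n + 1`,
let `π : 𝒳 = {(x, a) | Σᵢ aᵢ xᵢ(x) = 0} ⟶ (ℙᴺ)^*` be the universal hyperplane section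
(`Motives/UniversalHyperplaneSection`). The main result,
`exists_smoothOfRelativeDimension_morphismRestrict_of_fibre`, is the scheme-theoretic content of
"by the definition of `U`, `φ = pr₂` is a submersion with smooth fibre `X_H` over `H`" (Voisin II
§3.2.2): **if the fibre `X ∩ H_t` of `π` over a rational point `t` is smooth of relative dimension
`n`, then `π` is smooth of relative dimension `n` over a Zariski neighbourhood of `t`.** It is the
last input of the monodromy package of Lefschetz pencils
(`HodgeTheory/HyperplaneSectionMonodromyHolds`).

Proof (Voisin II §2.1.1: the incidence variety is a projective bundle over `X`; Hartshorne III
Prop. 10.4: smoothness via the Jacobian criterion on the fibres):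

* `exists_smoothOfRelativeDimension_morphismRestrict_of_forall` — for a closed map, a source-local
  property holding near every point of a fibre holds over a neighbourhood of the fibre;
* `exists_chart_indices` — every point of `𝒳` lies in a chart `ι⁻¹D₊(x_j) ×ₖ D₊(a_l)` with `j ≠ l`;
* the local model (`modelHom`, `modelImm`, `exists_modelIso`): over such a chart, with `X' ∋ pr₁(x)`
  affine, `𝒳 ∩ (X' × D₊(a_l)) ≅ Spec Γ(X, X')[aᵢ/a_l : i ≠ j, l]`, the graph of
  `a_j/a_l = -(u_l + Σ uᵢ aᵢ/a_l)` (`Motives/UniversalHyperplaneSectionChart` for the local equation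
  and the uniqueness of the reduced structure, `Motives/HyperplaneSectionChartAlgebra` for the
  elimination);
* `exists_minor_of_model` — the fibrewise Jacobian criterion
  (`Smoothening/JacobianCriterionFibre`) for the presentation `k[y][T]/(f, h)` of the model over
  `k[y] = Γ(D₊(a_l))` (`presentationAlgEquiv`): a smooth fibre of the expected dimension forces a
  nonvanishing maximal minor `Δ`, and the model is standard smooth of relative dimension `n` over
  `k[y]` on `D(Δ)` (`Smoothening/JacobianCriterion`);
* `exists_smoothOfRelativeDimension_nhd_of_fibre` assembles these at a point `x` over `t`
  (the piece of the fibre of the model is an open piece of `𝒳_t`, `pullbackSpecIso`), and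
  `exists_smoothOfRelativeDimension_morphismRestrict_of_fibre` spreads over the (proper) fibre.

## References

* [VoisinHodgeII2003] C. Voisin, Hodge Theory and Complex Algebraic Geometry II, CUP 2003, §2.1.1,
  §3.2.2.
* [Hartshorne1977] R. Hartshorne, Algebraic Geometry, II Prop. 2.5, III Prop. 10.1, Prop. 10.4.
* [GortzWedhorn2020] U. Görtz, T. Wedhorn, Algebraic Geometry I, 2nd ed., Def. 6.14.
* [StacksProject] The Stacks Project, Tag 00T6.
-/

noncomputable section

open CategoryTheory AlgebraicGeometry Limits MonoidalCategory CartesianMonoidalCategory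
  HomogeneousLocalization TensorProduct

universe u

namespace Literature.AlgebraicGeometry.Motives.UniversalHyperplaneSection

/-! ### Spreading a source-local property over a neighbourhood of a fibre of a closed map -/

section Spread

variable {X Y : Scheme.{u}} (f : X ⟶ Y) (n : ℕ)

/-- **Spreading out.** Let `f : X ⟶ Y` be a closed map and `y ∈ Y`. If every point of the fibre
`f⁻¹(y)` has an open neighbourhood `O ⊆ X` with `O ↪ X → Y` smooth of relative dimension `n`, then
`f` is smooth of relative dimension `n` over an open neighbourhood `V ∋ y`: take `W` the union of all
such `O` (over all points of `X`), `V = Y ∖ f(X ∖ W)`. [cite: Hartshorne1977, III Prop. 10.1 and Ex. 10.2] -/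
theorem exists_smoothOfRelativeDimension_morphismRestrict_of_forall (hf : IsClosedMap f.base) (y : Y)
    (h : ∀ x : X, f.base x = y → ∃ O : X.Opens, x ∈ O ∧ SmoothOfRelativeDimension n (O.ι ≫ f)) :
    ∃ V : Y.Opens, y ∈ V ∧ SmoothOfRelativeDimension n (f ∣_ V) := by
  -- `W` = union of all opens `O` with `O ↪ X → Y` smooth of relative dimension `n`
  let S : Set X.Opens := {O | SmoothOfRelativeDimension n (O.ι ≫ f)}
  let W : X.Opens := sSup S
  have hWS : ∀ O ∈ S, O ≤ W := fun O hO ↦ le_sSup hO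
  -- `W ↪ X → Y` is smooth of relative dimension `n` (local on the source)
  have hW : SmoothOfRelativeDimension n (W.ι ≫ f) := by
    refine IsZariskiLocalAtSource.of_iSup_eq_top (P := @SmoothOfRelativeDimension n)
      (fun O : S ↦ W.ι ⁻¹ᵁ O.1) ?_ (fun O ↦ ?_)
    · refine top_le_iff.mp fun w _ ↦ ?_
      have hw : (w.1 : X) ∈ (W : Set X) := w.2
      change w.1 ∈ ((sSup S : X.Opens) : Set X) at hw
      rw [TopologicalSpace.Opens.coe_sSup, Set.mem_iUnion₂] at hw
      obtain ⟨O, hO, hwO⟩ := hw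
      exact TopologicalSpace.Opens.mem_iSup.2 ⟨⟨O, hO⟩, hwO⟩
    · have e : (W.ι ⁻¹ᵁ O.1).ι ≫ W.ι ≫ f = (Scheme.Opens.isoOfLE (hWS O.1 O.2)).hom ≫ O.1.ι ≫ f := by
        rw [← Category.assoc, ← Category.assoc, Scheme.Opens.isoOfLE_hom_ι]
      rw [e, MorphismProperty.cancel_left_of_respectsIso (P := @SmoothOfRelativeDimension n)]
      exact O.2
  -- `V = Y ∖ f(X ∖ W)` is an open neighbourhood of `y` with `f⁻¹ V ⊆ W`
  have hcl : IsClosed (f.base '' (W : Set X)ᶜ) := hf _ W.isOpen.isClosed_compl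
  refine ⟨⟨(f.base '' (W : Set X)ᶜ)ᶜ, hcl.isOpen_compl⟩, ?_, ?_⟩
  · rintro ⟨x, hx, hxy⟩
    obtain ⟨O, hxO, hO⟩ := h x hxy
    exact hx (hWS O hO hxO)
  · set V : Y.Opens := ⟨(f.base '' (W : Set X)ᶜ)ᶜ, hcl.isOpen_compl⟩ with hV
    have hle : f ⁻¹ᵁ V ≤ W := by
      intro x hx
      by_contra hxW
      exact hx ⟨x, hxW, rfl⟩
    have h1 : SmoothOfRelativeDimension n ((f ⁻¹ᵁ V).ι ≫ f) := by
      rw [← X.homOfLE_ι hle, Category.assoc]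
      exact IsZariskiLocalAtSource.comp hW _
    rw [← morphismRestrict_ι] at h1
    haveI := smoothOfRelativeDimension_isStableUnderBaseChange n
    exact MorphismProperty.of_postcomp (W := @SmoothOfRelativeDimension n) (W' := @IsOpenImmersion)
      (f ∣_ V) V.ι (inferInstance : IsOpenImmersion _) h1

end Spread

/-! ### Choice of the chart at a point of `𝒳` -/

section ChartChoice

attribute [local instance] MvPolynomial.gradedAlgebra chartBaseRingAlgebra sectionsAlgebra

variable {k : Type u} [Field k] {N : ℕ} {X : SchemeOver k} (ι : X ⟶ projectiveSpace N k)

/-- Notation-free abbreviation: the grading of `k[x₀, …, x_N]`. -/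
local notation "𝒜" => Segre.grading (Fin (N + 1)) k

omit [Field k] in
/-- Every point of `ℙᴺ_k` lies in some standard chart `D₊(xᵢ)` (the `xᵢ` generate the irrelevant
ideal). [cite: Hartshorne1977, II Prop. 2.5] -/
theorem exists_mem_basicOpen_X [Field k] (p : Proj 𝒜) :
    ∃ i : Fin (N + 1), p ∈ Proj.basicOpen 𝒜 (MvPolynomial.X i) := by
  by_contra! h
  simp only [Proj.mem_basicOpen, not_not] at h
  refine p.not_irrelevant_le fun a ha ↦ ?_
  exact Ideal.span_le.mpr (Set.range_subset_iff.mpr h) (Segre.irrelevant_le_span_X (Fin (N + 1)) k ha)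

variable (j l : Fin (N + 1)) (X' : X.left.affineOpens)

/-- Points of the chart: `x_i/x_j` vanishes at `chartα y` iff `uᵢ ⊗ 1` vanishes at `y`
(`chartα` is `Spec` of `x_i/x_j ↦ uᵢ ⊗ 1`). [folklore] -/
theorem frac_mem_chartα_iff (hX' : (X' : X.left.Opens) ≤ ι.left ⁻¹ᵁ Proj.basicOpen 𝒜 (MvPolynomial.X j))
    (y : Spec (.of (chartRing (X := X) l X'))) (i : Fin (N + 1)) :
    Segre.frac k j i ∈ ((chartα ι j l X' hX') y).asIdeal ↔
      secCoord ι j X' hX' i ⊗ₜ[k] (1 : chartBaseRing N l) ∈ y.asIdeal := by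
  rw [chartα, Scheme.Hom.comp_apply, Scheme.Hom.comp_apply, Spec.map_apply, Spec.map_apply, Spec.map_apply]
  simp only [PrimeSpectrum.comap_asIdeal, Ideal.mem_comap]
  exact Iff.rfl

/-- **At a point of `𝒳` in the chart `(l, l)` some `x_i/x_l`, `i ≠ l`, does not vanish**: otherwise
all `uᵢ ⊗ 1`, `i ≠ l`, vanish at the point, and so does `g = 1 + Σ_{i ≠ l} (uᵢ ⊗ 1)(1 ⊗ aᵢ/a_l)`,
forcing `1 = 0` at the point. [folklore] -/
theorem exists_ne_frac_not_mem (hX' : (X' : X.left.Opens) ≤ ι.left ⁻¹ᵁ Proj.basicOpen 𝒜 (MvPolynomial.X l))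
    (y : Spec (.of (chartRing (X := X) l X')))
    (hy : y ∈ PrimeSpectrum.zeroLocus {incidenceFun ι l l X' hX'}) :
    ∃ i, i ≠ l ∧ Segre.frac k l i ∉ ((chartα ι l l X' hX') y).asIdeal := by
  by_contra! h
  have hmem : ∀ i, i ≠ l → secCoord ι l X' hX' i ⊗ₜ[k] (1 : chartBaseRing N l) ∈ y.asIdeal :=
    fun i hi ↦ (frac_mem_chartα_iff ι l l X' hX' y i).1 (h i hi)
  have hg : incidenceFun ι l l X' hX' ∈ y.asIdeal := by
    have := (PrimeSpectrum.mem_zeroLocus _ _).1 hy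
    rwa [Set.singleton_subset_iff] at this
  apply y.2.ne_top
  rw [Ideal.eq_top_iff_one]
  have e : (1 : chartRing (X := X) l X') = incidenceFun ι l l X' hX' -
      ∑ i ∈ Finset.univ.erase l, (secCoord ι l X' hX' i ⊗ₜ[k] (1 : chartBaseRing N l)) *
        ((1 : Γ(X.left, (X' : X.left.Opens))) ⊗ₜ[k] Segre.frac k l i) := by
    rw [incidenceFun, ← Finset.add_sum_erase _ _ (Finset.mem_univ l), secCoord_self, Segre.frac_self]
    simp only [Algebra.TensorProduct.tmul_mul_tmul, mul_one, one_mul, add_sub_cancel_right]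
    rfl
  rw [e]
  refine Ideal.sub_mem _ hg (Ideal.sum_mem _ fun i hi ↦ Ideal.mul_mem_right _ _ (hmem i ?_))
  exact Finset.ne_of_mem_erase hi

/-- `ι ∘ pr₁ ∘ chart = (D₊(x_j) ↪ ℙᴺ) ∘ chartα` on points. [folklore] -/
theorem ι_fst_chartImm_apply (hX' : (X' : X.left.Opens) ≤ ι.left ⁻¹ᵁ Proj.basicOpen 𝒜 (MvPolynomial.X j))
    (y : Spec (.of (chartRing (X := X) l X'))) :
    ι.left (pullback.fst X.hom (dualProjectiveSpace N k).hom (chartImm X l X' y)) =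
      Segre.chartι k j (chartα ι j l X' hX' y) := by
  have h1 : pullback.fst X.hom (dualProjectiveSpace N k).hom (chartImm X l X' y) =
      X'.2.fromSpec (Spec.map (CommRingCat.ofHom
        (algebraMap Γ(X.left, (X' : X.left.Opens)) (chartRing l X'))) y) := by
    rw [← Scheme.Hom.comp_apply, chartImm_fst, Scheme.Hom.comp_apply]
  have h2 := congrArg (fun φ : Spec (.of (chartRing (X := X) l X')) ⟶ Proj 𝒜 ↦ φ y)
    (specMap_fromSpec_ι ι j l X' hX')
  simp only [Scheme.Hom.comp_apply] at h2
  rw [h1]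
  exact h2

variable {ι j l X'} in
/-- `chartι q ∈ D₊(x_i) ↔ x_i/x_j ∉ q` for a point `q` of the chart `D₊(x_j)`. [folklore] -/
theorem chartι_mem_basicOpen_iff (q : Spec (.of (Away 𝒜 (MvPolynomial.X j)))) (i : Fin (N + 1)) :
    Segre.chartι k j q ∈ Proj.basicOpen 𝒜 (MvPolynomial.X i) ↔ Segre.frac k j i ∉ q.asIdeal := by
  have h := Set.ext_iff.mp (ProjSubscheme.awayι_preimage_zeroLocus 𝒜 (Segre.X_mem k j) zero_lt_one
    (Segre.X_mem k i) zero_lt_one) q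
  rw [Set.mem_preimage] at h
  have h1 : Segre.chartι k j q ∈ Proj.basicOpen 𝒜 (MvPolynomial.X i) ↔
      Segre.chartι k j q ∉ ProjectiveSpectrum.zeroLocus 𝒜 {MvPolynomial.X i} :=
    (Proj.mem_basicOpen 𝒜 _ _).trans
      (not_congr ((ProjectiveSpectrum.mem_zeroLocus _ _ _).trans Set.singleton_subset_iff)).symm
  have h2 : q ∈ PrimeSpectrum.zeroLocus {Segre.frac k j i} ↔ Segre.frac k j i ∈ q.asIdeal :=
    (PrimeSpectrum.mem_zeroLocus _ _).trans Set.singleton_subset_iff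
  rw [h1, not_iff_not]
  exact h.trans h2

variable (N) in
/-- **Choice of the chart.** Every point `x` of the universal hyperplane section lies in a chart
`ι⁻¹D₊(x_j) ×ₖ D₊(a_l)` with `j ≠ l` (for `ι` affine, e.g. a closed immersion): choose `D₊(a_l) ∋ π(x)`;
if `pr₁(x)` were in no `ι⁻¹D₊(x_j)`, `j ≠ l`, the incidence equation at `x` would read `1 = 0`
(`exists_ne_frac_not_mem`). [cite: VoisinHodgeII2003, §2.1.1] -/
theorem exists_chart_indices [IsAffineHom ι.left] (x : (universalHyperplaneSection N ι).left) :
    ∃ j l : Fin (N + 1), j ≠ l ∧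
      (toX N ι).left x ∈ ι.left ⁻¹ᵁ Proj.basicOpen 𝒜 (MvPolynomial.X j) ∧
      (proj N ι).left x ∈ Proj.basicOpen 𝒜 (MvPolynomial.X l) := by
  obtain ⟨l, hl⟩ := exists_mem_basicOpen_X ((proj N ι).left x)
  obtain ⟨i₀, hi₀⟩ := exists_mem_basicOpen_X (ι.left ((toX N ι).left x))
  by_cases hil : i₀ ≠ l
  · exact ⟨i₀, l, hil, hi₀, hl⟩
  obtain rfl : i₀ = l := not_ne_iff.mp hil
  -- the chart `(l, l)` on the affine open `X' = ι⁻¹D₊(x_l)`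
  have hinst : IsAffineHom ι.left := inferInstance
  let X' : X.left.affineOpens := ⟨ι.left ⁻¹ᵁ Proj.basicOpen 𝒜 (MvPolynomial.X i₀),
    @IsAffineOpen.preimage _ _ _
      (ProjSubscheme.affineBasicOpen 𝒜 (MvPolynomial.X i₀) (Segre.X_mem k i₀) zero_lt_one).2 ι.left hinst⟩
  have hX' : (X' : X.left.Opens) ≤ ι.left ⁻¹ᵁ Proj.basicOpen 𝒜 (MvPolynomial.X i₀) := le_rfl
  -- `x` lies in the chart
  have hxr : (emb N ι).left x ∈ Set.range (chartImm X i₀ X') := by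
    rw [range_chartImm]
    exact ⟨hi₀, hl⟩
  obtain ⟨y, hy⟩ := hxr
  -- and in the incidence locus, i.e. `g(y) = 0`
  have hyz : y ∈ PrimeSpectrum.zeroLocus {incidenceFun ι i₀ i₀ X' hX'} := by
    rw [← preimage_chartImm_incidenceLocus ι i₀ i₀ X' hX']
    change chartImm X i₀ X' y ∈ (incidenceLocus N ι : Set (X ⊗ dualProjectiveSpace N k).left)
    rw [hy, ← range_emb]
    exact ⟨x, rfl⟩
  obtain ⟨i, hil', hi⟩ := exists_ne_frac_not_mem ι i₀ X' hX' y hyz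
  refine ⟨i, i₀, hil', ?_, hl⟩
  change ι.left ((toX N ι).left x) ∈ Proj.basicOpen 𝒜 (MvPolynomial.X i)
  have e : (toX N ι).left x = pullback.fst X.hom (dualProjectiveSpace N k).hom (chartImm X i₀ X' y) := by
    rw [hy]
    rfl
  rw [e, ι_fst_chartImm_apply ι i₀ i₀ X' hX' y]
  exact (chartι_mem_basicOpen_iff _ i).2 hi

end ChartChoice

/-! ### The local model of `𝒳` over a chart with `j ≠ l` -/

section LocalModel

attribute [local instance] MvPolynomial.gradedAlgebra chartBaseRingAlgebra sectionsAlgebra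

variable {k : Type u} [Field k] {N : ℕ} {X : SchemeOver k} (ι : X ⟶ projectiveSpace N k)

/-- Notation-free abbreviation: the grading of `k[x₀, …, x_N]`. -/
local notation "𝒜" => Segre.grading (Fin (N + 1)) k

variable (N) in
/-- The chart ring `(k[a]_{(a_l)})₀` is the polynomial ring `k[y₁, …, y_N]`, `a_{l.succAbove m}/a_l ↤ y_m`,
as rings (the tree's `ProjectiveSpace.chartAlgEquiv`). [cite: Hartshorne1977, II Prop. 2.5] -/
def chartBaseRingEquiv (l : Fin (N + 1)) : chartBaseRing (k := k) N l ≃+* MvPolynomial (Fin N) k :=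
  letI := ProjBaseChange.algebraBase 𝒜 (Submonoid.powers (MvPolynomial.X (R := k) l))
  (ProjectiveSpace.chartAlgEquiv k l).toRingEquiv

/-- `chartBaseRingEquiv` maps the constants `Segre.cst c` to `C c` (it is `k`-linear for the tree's
`ProjBaseChange.algebraBase`, whose structure map is `Segre.cst`). [folklore] -/
theorem chartBaseRingEquiv_cst (l : Fin (N + 1)) (c : k) :
    chartBaseRingEquiv N l (Segre.cst k (MvPolynomial.X l) c) = MvPolynomial.C c := by
  letI := ProjBaseChange.algebraBase 𝒜 (Submonoid.powers (MvPolynomial.X (R := k) l))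
  exact (ProjectiveSpace.chartAlgEquiv k l).commutes c

variable (N) in
/-- The chart ring `(k[a]_{(a_l)})₀ ≃ k[y₁, …, y_N]` as `k`-algebras for the structure `Segre.cst`
(`chartBaseRingAlgebra`). [cite: Hartshorne1977, II Prop. 2.5] -/
def chartBaseEquiv (l : Fin (N + 1)) : chartBaseRing (k := k) N l ≃ₐ[k] MvPolynomial (Fin N) k :=
  AlgEquiv.ofRingEquiv (f := chartBaseRingEquiv N l) (chartBaseRingEquiv_cst l)

/-- `chartBaseEquiv (a_{l.succAbove m}/a_l) = y_m`. [folklore] -/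
theorem chartBaseEquiv_frac_succAbove (l : Fin (N + 1)) (m : Fin N) :
    chartBaseEquiv N l (Segre.frac k l (l.succAbove m)) = MvPolynomial.X m := by
  letI := ProjBaseChange.algebraBase 𝒜 (Submonoid.powers (MvPolynomial.X (R := k) l))
  change ProjectiveSpace.chartAlgEquiv k l (Segre.frac k l (l.succAbove m)) = _
  exact ProjectiveSpaceCells.chartAlgEquiv_isLocalizationElem k N l m

/-- `chartBaseEquiv (a_l/a_l) = 1`. [folklore] -/
theorem chartBaseEquiv_frac_self (l : Fin (N + 1)) :
    chartBaseEquiv N l (Segre.frac k l l) = 1 := by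
  rw [Segre.frac_self, map_one]

/-- Transport of "`V(ker φ) = V(s)`" along a ring isomorphism `e : R ≃ S` with `e g = s`:
`V(ker (φ ∘ e)) = V(g)`. [folklore] -/
theorem zeroLocus_ker_comp_of_equiv {R S T : Type*} [CommRing R] [CommRing S] [CommRing T]
    (e : R ≃+* S) (φ : S →+* T) {g : R} {s : S} (hs : e g = s)
    (h : PrimeSpectrum.zeroLocus (RingHom.ker φ : Set S) = PrimeSpectrum.zeroLocus {s}) :
    PrimeSpectrum.zeroLocus (RingHom.ker (φ.comp e.toRingHom) : Set R) = PrimeSpectrum.zeroLocus {g} := by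
  ext P
  rw [PrimeSpectrum.mem_zeroLocus, PrimeSpectrum.mem_zeroLocus, Set.singleton_subset_iff, SetLike.mem_coe]
  let P' : PrimeSpectrum S := ⟨Ideal.comap e.symm.toRingHom P.asIdeal, Ideal.comap_isPrime _ _⟩
  have key : ((RingHom.ker (φ.comp e.toRingHom) : Ideal R) : Set R) ⊆ P.asIdeal ↔
      ((RingHom.ker φ : Ideal S) : Set S) ⊆ P'.asIdeal := by
    rw [SetLike.coe_subset_coe, SetLike.coe_subset_coe]
    constructor
    · intro hle x hx
      change e.symm x ∈ P.asIdeal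
      apply hle
      rw [RingHom.mem_ker, RingHom.comp_apply]
      change φ (e (e.symm x)) = 0
      rwa [RingEquiv.apply_symm_apply]
    · intro hle x hx
      have hx' : e x ∈ RingHom.ker φ := by rwa [RingHom.mem_ker] at hx ⊢
      have := hle hx'
      change e.symm (e x) ∈ P.asIdeal at this
      rwa [RingEquiv.symm_apply_apply] at this
  have hP' := Set.ext_iff.mp h P'
  rw [PrimeSpectrum.mem_zeroLocus, PrimeSpectrum.mem_zeroLocus, Set.singleton_subset_iff] at hP'
  rw [key, hP']
  change e.symm s ∈ P.asIdeal ↔ _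
  rw [← hs, RingEquiv.symm_apply_apply]

variable (j l : Fin (N + 1)) (X' : X.left.affineOpens) (m₀ : Fin N)

/-- The coefficients `w_m = u_{l.succAbove m} ∈ A = Γ(X, X')` of the incidence equation in the
coordinates `y_m = a_{l.succAbove m}/a_l`. [folklore] -/
def wfun (hX' : (X' : X.left.Opens) ≤ ι.left ⁻¹ᵁ Proj.basicOpen 𝒜 (MvPolynomial.X j)) (m : Fin N) : Γ(X.left, (X' : X.left.Opens)) := secCoord ι j X' hX' (l.succAbove m)

/-- The constant coefficient `w₀ = u_l` of the incidence equation. [folklore] -/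
def wzero (hX' : (X' : X.left.Opens) ≤ ι.left ⁻¹ᵁ Proj.basicOpen 𝒜 (MvPolynomial.X j)) : Γ(X.left, (X' : X.left.Opens)) := secCoord ι j X' hX' l

/-- `w_{m₀} = u_j = 1` when `l.succAbove m₀ = j`. [folklore] -/
theorem wfun_eq_one (hX' : (X' : X.left.Opens) ≤ ι.left ⁻¹ᵁ Proj.basicOpen 𝒜 (MvPolynomial.X j)) (hm₀ : l.succAbove m₀ = j) : wfun ι j l X' hX' m₀ = 1 := by
  rw [wfun, hm₀, secCoord_self]

/-- The chart ring in polynomial coordinates: `Γ(X, X') ⊗ₖ (k[a]_{(a_l)})₀ ≃ Γ(X, X') ⊗ₖ k[y]`.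
[folklore] -/
def chartRingEquiv :
    chartRing (X := X) l X' ≃ₐ[Γ(X.left, (X' : X.left.Opens))]
      Γ(X.left, (X' : X.left.Opens)) ⊗[k] MvPolynomial (Fin N) k :=
  Algebra.TensorProduct.congr AlgEquiv.refl (chartBaseEquiv N l)

/-- `chartRingEquiv (a ⊗ r) = a ⊗ chartBaseEquiv r`. [folklore] -/
@[simp]
theorem chartRingEquiv_tmul (a : Γ(X.left, (X' : X.left.Opens))) (r : chartBaseRing (k := k) N l) :
    chartRingEquiv l X' (a ⊗ₜ[k] r) = a ⊗ₜ[k] chartBaseEquiv N l r := by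
  simp [chartRingEquiv]

/-- In polynomial coordinates the incidence function `g = Σᵢ uᵢ ⊗ aᵢ/a_l` is
`w₀ ⊗ 1 + Σ_m w_m ⊗ y_m`. [folklore] -/
theorem chartRingEquiv_incidenceFun (hX' : (X' : X.left.Opens) ≤ ι.left ⁻¹ᵁ Proj.basicOpen 𝒜 (MvPolynomial.X j)) :
    chartRingEquiv l X' (incidenceFun ι j l X' hX') =
      HyperplaneSectionChart.incidenceTensor k Γ(X.left, (X' : X.left.Opens))
        (wfun ι j l X' hX') (wzero ι j l X' hX') := by
  rw [incidenceFun, map_sum, Fin.sum_univ_succAbove _ l, HyperplaneSectionChart.incidenceTensor]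
  simp only [chartRingEquiv_tmul, chartBaseEquiv_frac_succAbove, chartBaseEquiv_frac_self]
  rfl

/-- **The local model map** `θ : Γ(X, X') ⊗ₖ (k[a]_{(a_l)})₀ → A[y_m : m ≠ m₀]`: polynomial
coordinates followed by the elimination of `y_{m₀} = a_j/a_l`. [cite: VoisinHodgeII2003, §2.1.1] -/
def modelHom (hX' : (X' : X.left.Opens) ≤ ι.left ⁻¹ᵁ Proj.basicOpen 𝒜 (MvPolynomial.X j)) : chartRing (X := X) l X' →ₐ[Γ(X.left, (X' : X.left.Opens))]
    HyperplaneSectionChart.Model Γ(X.left, (X' : X.left.Opens)) m₀ :=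
  (HyperplaneSectionChart.elimTensor k Γ(X.left, (X' : X.left.Opens)) m₀ (wfun ι j l X' hX')
    (wzero ι j l X' hX')).comp (chartRingEquiv l X').toAlgHom

/-- `θ` is surjective. [folklore] -/
theorem modelHom_surjective (hX' : (X' : X.left.Opens) ≤ ι.left ⁻¹ᵁ Proj.basicOpen 𝒜 (MvPolynomial.X j)) : Function.Surjective (modelHom ι j l X' m₀ hX') :=
  (HyperplaneSectionChart.elimTensor_surjective k _ m₀ _ _).comp (chartRingEquiv l X').surjective

/-- **`V(ker θ) = V(g)`** in the chart (when `l.succAbove m₀ = j`). [folklore] -/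
theorem zeroLocus_ker_modelHom (hX' : (X' : X.left.Opens) ≤ ι.left ⁻¹ᵁ Proj.basicOpen 𝒜 (MvPolynomial.X j)) (hm₀ : l.succAbove m₀ = j) :
    PrimeSpectrum.zeroLocus (RingHom.ker (modelHom ι j l X' m₀ hX').toRingHom : Set (chartRing l X')) =
      PrimeSpectrum.zeroLocus {incidenceFun ι j l X' hX'} :=
  zeroLocus_ker_comp_of_equiv (chartRingEquiv l X').toRingEquiv
    (HyperplaneSectionChart.elimTensor k Γ(X.left, (X' : X.left.Opens)) m₀ (wfun ι j l X' hX')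
      (wzero ι j l X' hX')).toRingHom (chartRingEquiv_incidenceFun ι j l X' hX')
    (HyperplaneSectionChart.zeroLocus_ker_elimTensor k _ m₀ _ _ (wfun_eq_one ι j l X' m₀ hX' hm₀))

/-- **The local model as a closed subscheme of the chart**: `γ = Spec θ : Spec A[y_m : m ≠ m₀] ↪
Spec (Γ(X, X') ⊗ₖ (k[a]_{(a_l)})₀)`. [cite: VoisinHodgeII2003, §2.1.1] -/
def modelImm (hX' : (X' : X.left.Opens) ≤ ι.left ⁻¹ᵁ Proj.basicOpen 𝒜 (MvPolynomial.X j)) : Spec (.of (HyperplaneSectionChart.Model Γ(X.left, (X' : X.left.Opens)) m₀)) ⟶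
    Spec (.of (chartRing (X := X) l X')) :=
  Spec.map (CommRingCat.ofHom (modelHom ι j l X' m₀ hX').toRingHom)

/-- `γ` is a closed immersion (`θ` is surjective). [folklore] -/
instance isClosedImmersion_modelImm (hX' : (X' : X.left.Opens) ≤ ι.left ⁻¹ᵁ Proj.basicOpen 𝒜 (MvPolynomial.X j)) : IsClosedImmersion (modelImm ι j l X' m₀ hX') :=
  IsClosedImmersion.spec_of_surjective _ (modelHom_surjective ι j l X' m₀ hX')

/-- The image of `γ` is `V(g)` (when `l.succAbove m₀ = j`). [folklore] -/
theorem range_modelImm (hX' : (X' : X.left.Opens) ≤ ι.left ⁻¹ᵁ Proj.basicOpen 𝒜 (MvPolynomial.X j)) (hm₀ : l.succAbove m₀ = j) :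
    Set.range (modelImm ι j l X' m₀ hX') = PrimeSpectrum.zeroLocus {incidenceFun ι j l X' hX'} := by
  have h : ⇑(modelImm ι j l X' m₀ hX') = PrimeSpectrum.comap (modelHom ι j l X' m₀ hX').toRingHom :=
    funext fun x ↦ by rw [modelImm, Spec.map_apply]; rfl
  rw [h]
  exact (range_comap_of_surjective _ _ (modelHom_surjective ι j l X' m₀ hX')).trans
    (zeroLocus_ker_modelHom ι j l X' m₀ hX' hm₀)

/-- **The local structure of the universal hyperplane section**: for `X` reduced and
`l.succAbove m₀ = j` (so `j ≠ l`), the piece `𝒳 ∩ (X' ×ₖ D₊(a_l))` is isomorphic over the chart to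
the graph `Spec Γ(X, X')[y_m : m ≠ m₀]`. [cite: VoisinHodgeII2003, §2.1.1] -/
theorem exists_modelIso [IsReduced X.left] (hX' : (X' : X.left.Opens) ≤ ι.left ⁻¹ᵁ Proj.basicOpen 𝒜 (MvPolynomial.X j)) (hm₀ : l.succAbove m₀ = j) :
    ∃ e : Spec (.of (HyperplaneSectionChart.Model Γ(X.left, (X' : X.left.Opens)) m₀)) ≅
      chartSection X ι l X', e.hom ≫ chartSectionι ι l X' = modelImm ι j l X' m₀ hX' :=
  exists_iso_chartSection ι j l X' (modelImm ι j l X' m₀ hX') hX' (range_modelImm ι j l X' m₀ hX' hm₀)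

end LocalModel

/-! ### Fibres of the local model: general lemmas -/

section FibreLemmas

/-- `X ×_{W} Y ≅ X ×_{Z} Y` when `W ↪ Z` is a monomorphism (Mathlib `PullbackCone.isLimitOfCompMono`).
[folklore] -/
def pullbackCompMonoIso {C : Type*} [Category C] {X Y W Z : C} (f : X ⟶ W) (g : Y ⟶ W) (i : W ⟶ Z)
    [Mono i] [HasPullback f g] [HasPullback (f ≫ i) (g ≫ i)] :
    pullback (f ≫ i) (g ≫ i) ≅ pullback f g :=
  limit.isoLimitCone ⟨_, PullbackCone.isLimitOfCompMono f g i _ (pullbackIsPullback f g)⟩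

/-- Compatibility of `pullbackCompMonoIso` with the second projections. [folklore] -/
@[reassoc]
theorem pullbackCompMonoIso_hom_snd {C : Type*} [Category C] {X Y W Z : C} (f : X ⟶ W) (g : Y ⟶ W)
    (i : W ⟶ Z) [Mono i] [HasPullback f g] [HasPullback (f ≫ i) (g ≫ i)] :
    (pullbackCompMonoIso f g i).hom ≫ pullback.snd f g = pullback.snd (f ≫ i) (g ≫ i) :=
  limit.isoLimitCone_hom_π _ WalkingCospan.right

/-- **Smoothness of a piece of a fibre.** If the fibre `𝒳 ×_S T → T` of `π : 𝒳 → S` over `t : T → S`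
is smooth of relative dimension `n`, `u : M ↪ 𝒳` is an open immersion with `u ≫ π = a ≫ c` for an open
immersion `c : B ↪ S`, and `t = t' ≫ c`, then the fibre `M ×_B T → T` of `a` over `t'` is smooth of
relative dimension `n` (it is an open piece of the former). [folklore] -/
theorem smoothOfRelativeDimension_snd_of_piece {𝒳 S T M Bs : Scheme.{u}} (π : 𝒳 ⟶ S) (t : T ⟶ S)
    (u : M ⟶ 𝒳) [IsOpenImmersion u] (c : Bs ⟶ S) [IsOpenImmersion c] (a : M ⟶ Bs) (t' : T ⟶ Bs)
    (hu : u ≫ π = a ≫ c) (ht : t' ≫ c = t) (n : ℕ)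
    [SmoothOfRelativeDimension n (pullback.snd π t)] :
    SmoothOfRelativeDimension n (pullback.snd a t') := by
  -- the fibre of `u ≫ π` over `t` is an open piece of the fibre of `π`
  have h1 : SmoothOfRelativeDimension n (pullback.snd (u ≫ π) t) := by
    have e : pullback.map (u ≫ π) t π t u (𝟙 T) (𝟙 S) (by rw [Category.comp_id]) (by rw [Category.comp_id, Category.id_comp]) ≫
        pullback.snd π t = pullback.snd (u ≫ π) t := by
      rw [pullback.lift_snd, Category.comp_id]
    rw [← e]
    have := Scheme.pullback_map_isOpenImmersion (u ≫ π) t π t u (𝟙 T) (𝟙 S)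
      (by rw [Category.comp_id]) (by rw [Category.comp_id, Category.id_comp])
    have : SmoothOfRelativeDimension (0 + n)
        (pullback.map (u ≫ π) t π t u (𝟙 T) (𝟙 S) (by rw [Category.comp_id])
          (by rw [Category.comp_id, Category.id_comp]) ≫ pullback.snd π t) := inferInstance
    rwa [Nat.zero_add] at this
  -- rewrite `u ≫ π = a ≫ c`, `t = t' ≫ c` and cancel the monomorphism `c`
  have h2 : SmoothOfRelativeDimension n (pullback.snd (a ≫ c) (t' ≫ c)) := by
    have e : (pullback.congrHom hu.symm ht).hom ≫ pullback.snd (u ≫ π) t =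
        pullback.snd (a ≫ c) (t' ≫ c) := by
      simp only [pullback.congrHom, asIso_hom]
      erw [pullback.lift_snd]
      rw [Category.comp_id]
    rw [← e]
    exact MorphismProperty.RespectsIso.precomp (P := @SmoothOfRelativeDimension n) _ _ h1
  rw [← pullbackCompMonoIso_hom_snd a t' c] at h2
  exact (MorphismProperty.cancel_left_of_respectsIso (P := @SmoothOfRelativeDimension n) _ _).mp h2

/-- **From a smooth fibre of `Spec M → Spec B` to the ring**: if the fibre
`Spec M ×_{Spec B} Spec T → Spec T` is smooth of relative dimension `n`, then `T → M ⊗_B T` is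
locally standard smooth of relative dimension `n` (Mathlib `pullbackSpecIso`,
`HasRingHomProperty.Spec_iff`). [folklore] -/
theorem locally_isStandardSmoothOfRelativeDimension_includeRight (B M T : Type u) [CommRing B]
    [CommRing M] [CommRing T] [Algebra B M] [Algebra B T] (n : ℕ)
    (h : SmoothOfRelativeDimension n (pullback.snd (Spec.map (CommRingCat.ofHom (algebraMap B M)))
      (Spec.map (CommRingCat.ofHom (algebraMap B T))))) :
    RingHom.Locally (RingHom.IsStandardSmoothOfRelativeDimension n)
      ((Algebra.TensorProduct.includeRight : T →ₐ[B] M ⊗[B] T) : T →+* M ⊗[B] T) := by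
  have h' : SmoothOfRelativeDimension n (Spec.map (CommRingCat.ofHom (R := T) (S := M ⊗[B] T)
      (Algebra.TensorProduct.includeRight : T →ₐ[B] M ⊗[B] T))) := by
    rw [← pullbackSpecIso_inv_snd]
    exact MorphismProperty.RespectsIso.precomp (P := @SmoothOfRelativeDimension n) _ _ h
  exact (HasRingHomProperty.Spec_iff (P := @SmoothOfRelativeDimension n)).mp h'

/-- A ring map which is locally `Q` is `Q` after localising at some element outside any given prime.
[folklore] -/
theorem exists_not_mem_of_locally {Q : ∀ {R S : Type u} [CommRing R] [CommRing S], (R →+* S) → Prop}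
    {T F : Type u} [CommRing T] [CommRing F] (f : T →+* F) (h : RingHom.Locally Q f) (𝔮 : Ideal F)
    [𝔮.IsPrime] : ∃ s : F, s ∉ 𝔮 ∧ Q ((algebraMap F (Localization.Away s)).comp f) := by
  obtain ⟨S, hS, hQ⟩ := h
  have : ¬ (S ⊆ (𝔮 : Set F)) := fun hsub ↦ by
    have := Ideal.span_le.mpr hsub
    rw [hS, top_le_iff] at this
    exact Ideal.IsPrime.ne_top ‹_› this
  obtain ⟨s, hsS, hs𝔮⟩ := Set.not_subset.mp this
  exact ⟨s, hs𝔮, hQ s hsS⟩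

end FibreLemmas

/-! ### The Jacobian criterion applied to the local model -/

section Minor

/-- Localisations at corresponding elements along an algebra isomorphism are isomorphic
algebras: `A[1/a] ≃ₐ[R] A'[1/e a]` (Mathlib `IsLocalization.ringEquivOfRingEquiv`). [folklore] -/
def awayCongr {R A A' : Type*} [CommRing R] [CommRing A] [CommRing A'] [Algebra R A] [Algebra R A']
    (e : A ≃ₐ[R] A') (a : A) : Localization.Away a ≃ₐ[R] Localization.Away (e a) :=
  AlgEquiv.ofRingEquiv
    (f := IsLocalization.ringEquivOfRingEquiv (M := Submonoid.powers a) (T := Submonoid.powers (e a))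
      (Localization.Away a) (Localization.Away (e a)) e.toRingEquiv
      (by rw [Submonoid.map_powers]; rfl))
    fun r ↦ by
      rw [IsScalarTower.algebraMap_apply R A (Localization.Away a),
        IsLocalization.ringEquivOfRingEquiv_eq,
        IsScalarTower.algebraMap_apply R A' (Localization.Away (e a))]
      exact congrArg _ (e.commutes r)

attribute [local instance] Algebra.TensorProduct.rightAlgebra in
/-- **The Jacobian criterion for a model of `R[T]/(f)`.** Let `f₁, …, f_c ∈ B[T₁, …, T_m]`, `c ≤ m`,
`e : B[T]/(f) ≃ C` a `B`-algebra isomorphism, `B → k` a point with values in a field, `z'` a prime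
of the fibre ring `C ⊗_B k` and `s' ∉ z'` with `(C ⊗_B k)[1/s']` standard smooth over `k` of the
expected relative dimension `m - c`. Then there is `Δ' ∈ C` (the image of a `c × c` Jacobian minor)
with `Δ' ⊗ 1 ∉ z'` and `C[1/Δ']` standard smooth of relative dimension `m - c` over `B`
(`Smoothening/JacobianCriterionFibre` with the pushout `C ⊗_B k` of `B[T]/(f)` along `e`, and
`Smoothening/JacobianCriterion` transported along `e`).
[cite: GortzWedhorn2020, Def. 6.14 (p. 159)] [cite: StacksProject, Tag 00T6] -/
theorem exists_minor_of_model {B : Type u} [CommRing B] {mT c : ℕ}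
    (f : Fin c → MvPolynomial (Fin mT) B) (hcn : c ≤ mT) (C : Type u) [CommRing C] [Algebra B C]
    (e : Smoothening.Quot f ≃ₐ[B] C) (k : Type u) [Field k] [Algebra B k]
    (z' : PrimeSpectrum (C ⊗[B] k)) (s' : C ⊗[B] k) (hs' : s' ∉ z'.asIdeal)
    (hsm : Algebra.IsStandardSmoothOfRelativeDimension (mT - c) k (Localization.Away s')) :
    ∃ Δ' : C, Δ' ⊗ₜ[B] (1 : k) ∉ z'.asIdeal ∧
      Algebra.IsStandardSmoothOfRelativeDimension (mT - c) B (Localization.Away Δ') := by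
  -- `F = C ⊗_B k` as an algebra over `D = B[T]/(f)` through `e`; it is the pushout of `D` and `k`
  let F : Type u := C ⊗[B] k
  letI : Algebra (Smoothening.Quot f) F :=
    ((algebraMap C F).comp e.toRingEquiv.toRingHom).toAlgebra
  have halgQF : ∀ q : Smoothening.Quot f, algebraMap (Smoothening.Quot f) F q = e q ⊗ₜ[B] (1 : k) :=
    fun _ ↦ rfl
  haveI : IsScalarTower B (Smoothening.Quot f) F :=
    IsScalarTower.of_algebraMap_eq (R := B) (S := Smoothening.Quot f) (A := F) fun b ↦ by
      rw [halgQF, AlgEquiv.commutes, Algebra.TensorProduct.algebraMap_apply]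
  -- the comparison `D ⊗ k ≃ₖ C ⊗ k`
  let eF : Smoothening.Quot f ⊗[B] k ≃ₐ[B] F := Algebra.TensorProduct.congr e AlgEquiv.refl
  have eF_tmul : ∀ (q : Smoothening.Quot f) (c' : k), eF (q ⊗ₜ[B] c') = e q ⊗ₜ[B] c' := fun q c' ↦ by
    change Algebra.TensorProduct.congr e AlgEquiv.refl (q ⊗ₜ[B] c') = _
    rw [Algebra.TensorProduct.congr_apply, Algebra.TensorProduct.map_tmul]
    rfl
  let eFk : Smoothening.Quot f ⊗[B] k ≃ₐ[k] F := AlgEquiv.ofRingEquiv (f := eF.toRingEquiv) fun c' ↦ by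
    change eF ((1 : Smoothening.Quot f) ⊗ₜ[B] c') = (1 : C) ⊗ₜ[B] c'
    rw [eF_tmul, map_one]
  haveI : Algebra.IsPushout B k (Smoothening.Quot f) F :=
    Algebra.IsPushout.of_equiv (R := B) (R' := k) (S := Smoothening.Quot f)
      (S' := Smoothening.Quot f ⊗[B] k) eFk (RingHom.ext fun q ↦ by
        change eF (q ⊗ₜ[B] (1 : k)) = e q ⊗ₜ[B] (1 : k)
        exact eF_tmul q 1)
  -- the field-valued point `L = Frac (F / z')` (an algebra over `F`, `D`, `B` canonically)
  let L : Type u := FractionRing (F ⧸ z'.asIdeal)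
  have halgFL : ∀ x : F, algebraMap F L x = algebraMap (F ⧸ z'.asIdeal) L (Ideal.Quotient.mk z'.asIdeal x) :=
    fun _ ↦ rfl
  have halgQL : ∀ q : Smoothening.Quot f,
      algebraMap (Smoothening.Quot f) L q = algebraMap F L (algebraMap (Smoothening.Quot f) F q) :=
    fun _ ↦ rfl
  haveI : IsScalarTower (Smoothening.Quot f) F L :=
    IsScalarTower.of_algebraMap_eq (R := Smoothening.Quot f) (S := F) (A := L) fun _ ↦ rfl
  letI : Algebra (MvPolynomial (Fin mT) B) L :=
    ((algebraMap (Smoothening.Quot f) L).comp (algebraMap (MvPolynomial (Fin mT) B) (Smoothening.Quot f))).toAlgebra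
  letI : SMul (MvPolynomial (Fin mT) B) L := Algebra.toSMul
  haveI : IsScalarTower (MvPolynomial (Fin mT) B) (Smoothening.Quot f) L :=
    IsScalarTower.of_algebraMap_eq (R := MvPolynomial (Fin mT) B) (S := Smoothening.Quot f) (A := L)
      fun _ ↦ rfl
  haveI : IsScalarTower B (Smoothening.Quot f) L :=
    IsScalarTower.of_algebraMap_eq (R := B) (S := Smoothening.Quot f) (A := L) fun b ↦ by
      rw [halgQL, ← IsScalarTower.algebraMap_apply B (Smoothening.Quot f) F,
        ← IsScalarTower.algebraMap_apply B F L]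
  haveI : IsScalarTower B (MvPolynomial (Fin mT) B) L :=
    IsScalarTower.of_algebraMap_eq (R := B) (S := MvPolynomial (Fin mT) B) (A := L) fun b ↦ by
      rw [IsScalarTower.algebraMap_apply B (Smoothening.Quot f) L,
        IsScalarTower.algebraMap_apply B (MvPolynomial (Fin mT) B) (Smoothening.Quot f)]
      rfl
  have hinj : Function.Injective (algebraMap (F ⧸ z'.asIdeal) L) := IsFractionRing.injective _ _
  have hs : algebraMap F L s' ≠ 0 := by
    rw [halgFL, map_ne_zero_iff _ hinj, Ne, Ideal.Quotient.eq_zero_iff_mem]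
    exact hs'
  -- the fibrewise Jacobian criterion
  obtain ⟨a, ha, hne⟩ := Smoothening.exists_algebraMap_jacobianMinor_ne_zero_of_fibre f k F L hcn s' hs
  refine ⟨e (Smoothening.jacobianMinor f a ha), ?_, ?_⟩
  · intro hmem
    apply hne
    rw [halgQL, halgQF, halgFL, Ideal.Quotient.eq_zero_iff_mem.2 hmem, map_zero]
  · -- `C[1/e Δ] ≃_B D[1/Δ]` is standard smooth of relative dimension `mT - c`
    have h2 := Smoothening.isStandardSmoothOfRelativeDimension_away f a ha
      (Localization.Away (Smoothening.jacobianMinor f a ha))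
    exact Algebra.IsStandardSmoothOfRelativeDimension.of_algEquiv _
      (awayCongr e (Smoothening.jacobianMinor f a ha))

end Minor

/-! ### Assembly: smoothness of `π` near a point of a smooth fibre -/

section Assembly

attribute [local instance] MvPolynomial.gradedAlgebra chartBaseRingAlgebra sectionsAlgebra

variable {k : Type u} [Field k] {N : ℕ} {X : SchemeOver k} (ι : X ⟶ projectiveSpace N k)

/-- Notation-free abbreviation: the grading of `k[x₀, …, x_N]`. -/
local notation "𝒜" => Segre.grading (Fin (N + 1)) k

omit ι in
/-- **Standard smooth affine neighbourhoods.** On a `k`-scheme smooth of relative dimension `d`,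
every point has, inside any given open neighbourhood, an affine open neighbourhood whose ring of
sections is standard smooth of relative dimension `d` over the scalars (Mathlib's definition,
shrunk to a basic open; localisation keeps standard smoothness). [cite: Hartshorne1977, III Prop. 10.1] -/
theorem exists_affineOpens_isStandardSmoothOfRelativeDimension (d : ℕ) [SmoothOfRelativeDimension d X.hom]
    (p : X.left) (W : X.left.Opens) (hpW : p ∈ W) :
    ∃ X' : X.left.affineOpens, p ∈ (X' : X.left.Opens) ∧ (X' : X.left.Opens) ≤ W ∧
      (SchemeOver.scalarRingHom X X').IsStandardSmoothOfRelativeDimension d := by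
  obtain ⟨U', -, V, hV, hpV, e, hsm⟩ :=
    SmoothOfRelativeDimension.exists_isStandardSmoothOfRelativeDimension (n := d) (f := X.hom) p
  have hU'top : U' = ⊤ := by
    ext y
    simp only [TopologicalSpace.Opens.coe_top, Set.mem_univ, iff_true, SetLike.mem_coe]
    obtain rfl : y = X.hom.base p := Subsingleton.elim _ _
    exact e hpV
  subst hU'top
  have hsmV : (SchemeOver.scalarRingHom X V).IsStandardSmoothOfRelativeDimension d :=
    (RingHom.isStandardSmoothOfRelativeDimension_respectsIso.cancel_left_isIso
      (Scheme.ΓSpecIso (.of k)).inv (X.hom.appLE ⊤ V e)).mpr hsm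
  -- shrink to a basic open inside `W`
  obtain ⟨h, hle, hph⟩ := hV.exists_basicOpen_le ⟨p, hpW⟩ hpV
  have hU : IsAffineOpen (X.left.basicOpen h) := hV.basicOpen h
  haveI : IsLocalization.Away h Γ(X.left, X.left.basicOpen h) := hV.isLocalization_basicOpen h
  have h0 : (algebraMap Γ(X.left, V) Γ(X.left, X.left.basicOpen h)).IsStandardSmoothOfRelativeDimension 0 :=
    RingHom.IsStandardSmoothOfRelativeDimension.algebraMap_isLocalizationAway h
  have hcomp : (algebraMap Γ(X.left, V) Γ(X.left, X.left.basicOpen h)).comp (SchemeOver.scalarRingHom X V) =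
      SchemeOver.scalarRingHom X (X.left.basicOpen h) := by
    refine RingHom.ext fun c ↦ ?_
    rw [RingHom.comp_apply, SchemeOver.scalarRingHom_apply, SchemeOver.scalarRingHom_apply]
    change (X.hom.appLE ⊤ V le_top ≫ X.left.presheaf.map (homOfLE (X.left.basicOpen_le h)).op) _ = _
    rw [Scheme.Hom.appLE_map]
  have hsmU : (SchemeOver.scalarRingHom X (X.left.basicOpen h)).IsStandardSmoothOfRelativeDimension d := by
    have := RingHom.IsStandardSmoothOfRelativeDimension.comp h0 hsmV
    rw [hcomp, Nat.zero_add] at this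
    exact this
  exact ⟨⟨X.left.basicOpen h, hU⟩, hph, hle, hsmU⟩

/-- The structure map of the local model through the chart ring: `θ ∘ (r ↦ 1 ⊗ r) = (y ↦ subst) ∘ (R ≅ k[y])`.
[folklore] -/
theorem modelHom_includeRight (j l : Fin (N + 1)) (X' : X.left.affineOpens) (m₀ : Fin N)
    (hX' : (X' : X.left.Opens) ≤ ι.left ⁻¹ᵁ Proj.basicOpen 𝒜 (MvPolynomial.X j)) (r : chartBaseRing (k := k) N l) :
    modelHom ι j l X' m₀ hX' ((1 : Γ(X.left, (X' : X.left.Opens))) ⊗ₜ[k] r) =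
      MvPolynomial.aeval (R := k) (HyperplaneSectionChart.subst Γ(X.left, (X' : X.left.Opens)) m₀
        (wfun ι j l X' hX') (wzero ι j l X' hX')) (chartBaseEquiv N l r) := by
  rw [modelHom, AlgHom.comp_apply]
  have h1 : (chartRingEquiv l X').toAlgHom ((1 : Γ(X.left, (X' : X.left.Opens))) ⊗ₜ[k] r) =
      (1 : Γ(X.left, (X' : X.left.Opens))) ⊗ₜ[k] chartBaseEquiv N l r := chartRingEquiv_tmul l X' 1 r
  rw [h1]
  exact HyperplaneSectionChart.elimTensor_one_tmul k _ m₀ _ _ _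

variable (N) in
omit ι in
/-- The tree's chart `Spec k[y] ≅ D₊(a_l) ↪ (ℙᴺ)^*` (`ProjectiveSpaceCells.chartι`) is `Spec` of the
chart isomorphism followed by `D₊(a_l) ↪ (ℙᴺ)^*` (unfolding). [folklore] -/
theorem chartι_eq (l : Fin (N + 1)) :
    ProjectiveSpaceCells.chartι k N l =
      Spec.map (CommRingCat.ofHom (chartBaseRingEquiv (k := k) N l).toRingHom) ≫ chartBaseι N l := rfl

/-- **Smoothness of `π : 𝒳 ⟶ (ℙᴺ)^*` near a point of a smooth fibre.** Let `X` be smooth of relative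
dimension `n + 1` over `k` (and reduced), `ι : X ⟶ ℙᴺ` affine (e.g. a closed immersion), `t` a
`k`-point of `(ℙᴺ)^*` whose fibre `𝒳_t = X ∩ H_t` is smooth of relative dimension `n` over `k`, and
`x ∈ 𝒳` a point over `t`. Then `π` is smooth of relative dimension `n` on an open neighbourhood of
`x`: in a chart `X' × D₊(a_l) ∋ x` with `X' ⊆ ι⁻¹D₊(x_j)`, `j ≠ l`, `𝒳` is the graph
`Spec Γ(X, X')[aᵢ/a_l : i ≠ j, l]`, presented over `k[y] = Γ(D₊(a_l))` by the relations of `X'` and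
the incidence equation; the fibrewise Jacobian criterion at `x` gives a nonvanishing maximal minor,
hence standard smoothness of the expected relative dimension `n` on the corresponding basic open.
[cite: VoisinHodgeII2003, §2.1.1 and §3.2.2] [cite: Hartshorne1977, III Prop. 10.4] -/
theorem exists_smoothOfRelativeDimension_nhd_of_fibre (n : ℕ) [SmoothOfRelativeDimension (n + 1) X.hom]
    [IsReduced X.left] [IsAffineHom ι.left] (t : AlgPoints (dualProjectiveSpace N k) k)
    (hfib : SmoothOfRelativeDimension n (pullback.snd (proj N ι).left t.left))
    (x : (universalHyperplaneSection N ι).left) (hx : (proj N ι).left x = t.pt) :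
    ∃ O : (universalHyperplaneSection N ι).left.Opens, x ∈ O ∧
      SmoothOfRelativeDimension n (O.ι ≫ (proj N ι).left) := by
  classical
  -- 1. the chart `X' × D₊(a_l)`, `X' ⊆ ι⁻¹D₊(x_j)` standard smooth affine, `j = l.succAbove m₀`
  obtain ⟨j, l, hjl, hj, hl⟩ := exists_chart_indices N ι x
  obtain ⟨m₀, hm₀⟩ : ∃ m₀ : Fin N, l.succAbove m₀ = j := Fin.exists_succAbove_eq hjl
  obtain ⟨X', hpX', hX', hsmA⟩ := exists_affineOpens_isStandardSmoothOfRelativeDimension (X := X) (n + 1)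
    ((toX N ι).left x) (ι.left ⁻¹ᵁ Proj.basicOpen 𝒜 (MvPolynomial.X j)) hj
  -- notation
  let A : Type u := Γ(X.left, (X' : X.left.Opens))
  haveI hsmA' : Algebra.IsStandardSmoothOfRelativeDimension (n + 1) k A := hsmA
  -- 2. a finite presentation of `A` and lifts of the coefficients of the incidence equation
  obtain ⟨mT, c, f₀, hdim, hc, ⟨eA⟩⟩ := HyperplaneSectionChart.exists_fin_presentation k A (n + 1)
  have hsurj : ∀ a : A, ∃ q : MvPolynomial (Fin mT) k, eA (Ideal.Quotient.mk _ q) = a := fun a ↦ by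
    obtain ⟨q, hq⟩ := Ideal.Quotient.mk_surjective (eA.symm a)
    exact ⟨q, by rw [hq, AlgEquiv.apply_symm_apply]⟩
  choose U hU using fun m ↦ hsurj (wfun ι j l X' hX' m)
  obtain ⟨U₀, hU₀⟩ := hsurj (wzero ι j l X' hX')
  have hw : wfun ι j l X' hX' m₀ = 1 := wfun_eq_one ι j l X' m₀ hX' hm₀
  -- 3. the model `Spec A[y_m : m ≠ m₀]`, an open piece `u' : Spec Model ↪ 𝒳` of `𝒳` through `x`
  let Mdl : Type u := HyperplaneSectionChart.Model A m₀
  letI : Algebra (MvPolynomial (Fin N) k) Mdl :=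
    HyperplaneSectionChart.modelAlgebra k A m₀ (wfun ι j l X' hX') (wzero ι j l X' hX')
  let ePres : Smoothening.Quot (HyperplaneSectionChart.rels k f₀ U U₀) ≃ₐ[MvPolynomial (Fin N) k] Mdl :=
    HyperplaneSectionChart.presentationAlgEquiv k A m₀ (wfun ι j l X' hX') (wzero ι j l X' hX') f₀ eA U U₀
      hU hU₀ hw
  obtain ⟨e, he⟩ := exists_modelIso ι j l X' m₀ hX' hm₀
  let u' : Spec (.of Mdl) ⟶ (universalHyperplaneSection N ι).left := e.hom ≫ chartSectionToSection ι l X'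
  haveI : IsOpenImmersion u' := inferInstance
  -- `x ∈ range u'`
  have hxu : x ∈ Set.range u' := by
    have hx1 : x ∈ Set.range (chartSectionToSection ι l X') := by
      have h' : (emb N ι).left x ∈ Set.range (chartImm X l X') :=
        (Set.ext_iff.mp (range_chartImm (X := X) l X') ((emb N ι).left x)).mpr ⟨hpX', hl⟩
      obtain ⟨y, hy⟩ := h'
      obtain ⟨w, hw1, -⟩ := Scheme.Pullback.exists_preimage_pullback (f := (emb N ι).left)
        (g := chartImm X l X') x y hy.symm
      exact ⟨w, hw1⟩
    obtain ⟨y, hy⟩ := hx1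
    exact ⟨e.inv y, by rw [← hy]; change (e.inv ≫ e.hom ≫ chartSectionToSection ι l X') y = _; rw [Iso.inv_hom_id_assoc]⟩
  obtain ⟨𝔔, h𝔔⟩ := hxu
  -- 4. the chart `cB : Spec k[y] ≅ D₊(a_l) ↪ (ℙᴺ)^*` and `u' ≫ π = Spec (k[y] → Model) ≫ cB`
  let cB : Spec (.of (MvPolynomial (Fin N) k)) ⟶ (dualProjectiveSpace N k).left :=
    ProjectiveSpaceCells.chartι k N l
  haveI hcB : IsOpenImmersion cB := ProjectiveSpaceCells.isOpenImmersion_chartι k N l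
  haveI : Subsingleton ((specOver k k).left) := inferInstanceAs (Subsingleton (PrimeSpectrum k))
  have hu' : u' ≫ (proj N ι).left =
      Spec.map (CommRingCat.ofHom (algebraMap (MvPolynomial (Fin N) k) Mdl)) ≫ cB := by
    -- `u' ≫ π = e.hom ≫ (𝒳_W ↪ 𝒳) ≫ emb ≫ pr₂ = modelImm ≫ chartβ ≫ (D₊(a_l) ↪ (ℙᴺ)^*)`
    have s1 : u' ≫ (proj N ι).left =
        modelImm ι j l X' m₀ hX' ≫ chartβ l X' ≫ chartBaseι N l := by
      calc u' ≫ (proj N ι).left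
          = e.hom ≫ chartSectionToSection ι l X' ≫ (emb N ι).left ≫
              pullback.snd X.hom (dualProjectiveSpace N k).hom := by
            change (e.hom ≫ chartSectionToSection ι l X') ≫ (proj N ι).left = _
            rw [Category.assoc]; rfl
        _ = e.hom ≫ chartSectionι ι l X' ≫ chartImm X l X' ≫
              pullback.snd X.hom (dualProjectiveSpace N k).hom := by
            rw [chartSectionToSection_emb_assoc]
            exact congrArg (e.hom ≫ ·) (Category.assoc _ _ _)
        _ = modelImm ι j l X' m₀ hX' ≫ chartβ l X' ≫ chartBaseι N l := by
            rw [chartImm_snd, ← he, Category.assoc]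
    -- ring level: `θ ∘ (1 ⊗ -) = (y ↦ subst) ∘ (R ≅ k[y])`
    have s2 : CommRingCat.ofHom (RingHomClass.toRingHom (Algebra.TensorProduct.includeRight (R := k)
          (A := Γ(X.left, (X' : X.left.Opens))) (B := chartBaseRing (k := k) N l))) ≫
        CommRingCat.ofHom (modelHom ι j l X' m₀ hX').toRingHom =
        CommRingCat.ofHom (chartBaseRingEquiv (k := k) N l).toRingHom ≫
          CommRingCat.ofHom (algebraMap (MvPolynomial (Fin N) k) Mdl) := by
      apply CommRingCat.hom_ext
      refine RingHom.ext fun r ↦ ?_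
      simp only [CommRingCat.hom_comp, CommRingCat.hom_ofHom, RingHom.comp_apply]
      exact modelHom_includeRight ι j l X' m₀ hX' r
    rw [s1, modelImm, chartβ, ← Spec.map_comp_assoc, s2, Spec.map_comp_assoc]
    rfl
  -- 5. `t` factors through `cB`: `t = Spec (ev) ≫ cB`
  have hrange : Set.range t.left ⊆ Set.range cB := by
    rintro _ ⟨y, rfl⟩
    obtain rfl : y = IsLocalRing.closedPoint k := Subsingleton.elim _ _
    change t.pt ∈ Set.range (ProjectiveSpaceCells.chartι k N l)
    rw [ProjectiveSpaceCells.range_chartι]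
    rw [← hx]
    exact hl
  let tb : Spec (.of k) ⟶ Spec (.of (MvPolynomial (Fin N) k)) := IsOpenImmersion.lift cB t.left hrange
  have htb : tb ≫ cB = t.left := IsOpenImmersion.lift_fac cB t.left hrange
  let evB : CommRingCat.of (MvPolynomial (Fin N) k) ⟶ CommRingCat.of k := (Spec.fullyFaithful.preimage tb).unop
  have hevB : Spec.map evB = tb := by
    have := Spec.fullyFaithful.map_preimage tb
    rwa [Scheme.Spec_map] at this
  letI : Algebra (MvPolynomial (Fin N) k) k := evB.hom.toAlgebra
  have htb' : Spec.map (CommRingCat.ofHom (algebraMap (MvPolynomial (Fin N) k) k)) = tb := by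
    rw [← hevB]; rfl
  -- 6. the point `z'` of the fibre `Spec (Model ⊗ k)` above `𝔔`
  have h𝔔t : Spec.map (CommRingCat.ofHom (algebraMap (MvPolynomial (Fin N) k) Mdl)) 𝔔 =
      Spec.map (CommRingCat.ofHom (algebraMap (MvPolynomial (Fin N) k) k)) (IsLocalRing.closedPoint k) := by
    apply cB.isOpenEmbedding.injective
    rw [← Scheme.Hom.comp_apply, ← Scheme.Hom.comp_apply, ← hu', htb', htb, Scheme.Hom.comp_apply, h𝔔, hx]
    rfl
  obtain ⟨z, hz𝔔, -⟩ := Scheme.Pullback.exists_preimage_pullback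
    (f := Spec.map (CommRingCat.ofHom (algebraMap (MvPolynomial (Fin N) k) Mdl)))
    (g := Spec.map (CommRingCat.ofHom (algebraMap (MvPolynomial (Fin N) k) k))) 𝔔 (IsLocalRing.closedPoint k) h𝔔t
  let z' : Spec (.of (Mdl ⊗[MvPolynomial (Fin N) k] k)) := (pullbackSpecIso (MvPolynomial (Fin N) k) Mdl k).hom z
  have hz' : Spec.map (CommRingCat.ofHom (Algebra.TensorProduct.includeLeftRingHom
      (R := MvPolynomial (Fin N) k) (A := Mdl) (B := k))) z' = 𝔔 := by
    rw [← hz𝔔]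
    change ((pullbackSpecIso (MvPolynomial (Fin N) k) Mdl k).hom ≫ Spec.map _) z = _
    rw [pullbackSpecIso_hom_fst]
  -- 7. the fibre is smooth at `z'`: some `s' ∉ z'` with `(Model ⊗ k)[1/s']` standard smooth of rel. dim. `n`
  haveI : SmoothOfRelativeDimension n (pullback.snd (proj N ι).left t.left) := hfib
  have hpiece := smoothOfRelativeDimension_snd_of_piece (proj N ι).left t.left u' cB
    (Spec.map (CommRingCat.ofHom (algebraMap (MvPolynomial (Fin N) k) Mdl)))
    (Spec.map (CommRingCat.ofHom (algebraMap (MvPolynomial (Fin N) k) k))) hu' (by rw [htb']; exact htb) n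
  have hloc := locally_isStandardSmoothOfRelativeDimension_includeRight (MvPolynomial (Fin N) k) Mdl k n hpiece
  obtain ⟨s', hs', hQ⟩ := exists_not_mem_of_locally _ hloc z'.asIdeal
  letI := Algebra.TensorProduct.rightAlgebra (R := MvPolynomial (Fin N) k) (A := Mdl) (B := k)
  have hsm' : Algebra.IsStandardSmoothOfRelativeDimension (mT - (c + 1)) k (Localization.Away s') := by
    have hn : mT - (c + 1) = n := by omega
    rw [hn]
    have hQ' : (algebraMap k (Localization.Away s')).IsStandardSmoothOfRelativeDimension n := hQ
    exact (RingHom.isStandardSmoothOfRelativeDimension_algebraMap n).mp hQ'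
  -- 8. the Jacobian criterion: `Δ' ∉ 𝔔` with `Model[1/Δ']` standard smooth of rel. dim. `n` over `k[y]`
  obtain ⟨Δ', hΔ'z, hΔ'sm⟩ := exists_minor_of_model (HyperplaneSectionChart.rels k f₀ U U₀) (by omega) Mdl ePres k
    z' s' hs' hsm'
  have hΔ'𝔔 : Δ' ∉ 𝔔.asIdeal := by
    intro hmem
    apply hΔ'z
    rw [← hz', Spec.map_apply] at hmem
    simpa [PrimeSpectrum.comap_asIdeal, Ideal.mem_comap] using hmem
  -- 9. the neighbourhood: the image of `D(Δ') ⊆ Spec Model` in `𝒳`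
  let uΔ : Spec (.of (Localization.Away Δ')) ⟶ (universalHyperplaneSection N ι).left :=
    Spec.map (CommRingCat.ofHom (algebraMap Mdl (Localization.Away Δ'))) ≫ u'
  haveI : IsOpenImmersion uΔ := inferInstance
  refine ⟨uΔ.opensRange, ?_, ?_⟩
  · -- `x = u' 𝔔` with `𝔔 ∈ D(Δ')`
    have : 𝔔 ∈ Set.range (Spec.map (CommRingCat.ofHom (algebraMap Mdl (Localization.Away Δ')))) := by
      have hr : Set.range ⇑(Spec.map (CommRingCat.ofHom (algebraMap Mdl (Localization.Away Δ')))) =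
          ((PrimeSpectrum.basicOpen Δ' : TopologicalSpace.Opens (PrimeSpectrum Mdl)) : Set (PrimeSpectrum Mdl)) := by
        have := PrimeSpectrum.localization_away_comap_range (Localization.Away Δ') Δ'
        refine Eq.trans ?_ this
        congr 1
      rw [hr]
      exact hΔ'𝔔
    obtain ⟨q, hq⟩ := this
    exact ⟨q, by change (Spec.map _ ≫ u') q = x; rw [Scheme.Hom.comp_apply, hq, h𝔔]⟩
  · -- `uΔ ≫ π = Spec (k[y] → Model[1/Δ']) ≫ cB` is smooth of relative dimension `n`
    have hn : mT - (c + 1) = n := by omega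
    have hsmB : (algebraMap (MvPolynomial (Fin N) k) (Localization.Away Δ')).IsStandardSmoothOfRelativeDimension n := by
      have h' : Algebra.IsStandardSmoothOfRelativeDimension n (MvPolynomial (Fin N) k) (Localization.Away Δ') :=
        hn ▸ hΔ'sm
      exact (RingHom.isStandardSmoothOfRelativeDimension_algebraMap n).mpr h'
    have h1 : SmoothOfRelativeDimension n
        (Spec.map (CommRingCat.ofHom (algebraMap (MvPolynomial (Fin N) k) (Localization.Away Δ')))) :=
      (HasRingHomProperty.Spec_iff (P := @SmoothOfRelativeDimension n)).mpr
        (RingHom.locally_of RingHom.isStandardSmoothOfRelativeDimension_respectsIso _ hsmB)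
    have h2 : SmoothOfRelativeDimension n
        (Spec.map (CommRingCat.ofHom (algebraMap (MvPolynomial (Fin N) k) (Localization.Away Δ'))) ≫ cB) := by
      have : SmoothOfRelativeDimension (n + 0)
          (Spec.map (CommRingCat.ofHom (algebraMap (MvPolynomial (Fin N) k) (Localization.Away Δ'))) ≫ cB) :=
        inferInstance
      rwa [Nat.add_zero] at this
    have h3 : uΔ ≫ (proj N ι).left =
        Spec.map (CommRingCat.ofHom (algebraMap (MvPolynomial (Fin N) k) (Localization.Away Δ'))) ≫ cB := by
      change (Spec.map _ ≫ u') ≫ _ = _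
      rw [Category.assoc, hu', ← Category.assoc, ← Spec.map_comp]
      congr 2
    have h4 : uΔ.opensRange.ι ≫ (proj N ι).left = uΔ.isoOpensRange.inv ≫ (uΔ ≫ (proj N ι).left) := by
      rw [← Category.assoc]
      congr 1
      rw [Iso.eq_inv_comp, Scheme.Hom.isoOpensRange_hom_ι]
    rw [h4, MorphismProperty.cancel_left_of_respectsIso (P := @SmoothOfRelativeDimension n), h3]
    exact h2

/-- **`π : 𝒳 ⟶ (ℙᴺ)^*` is smooth of relative dimension `n` over a Zariski neighbourhood of every
rational point with smooth `n`-dimensional fibre** (`X` smooth of relative dimension `n + 1`, reduced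
and proper over `k`, `ι` affine): smoothness near each point of the fibre
(`exists_smoothOfRelativeDimension_nhd_of_fibre`) spread over a neighbourhood of the whole fibre by
properness (`exists_smoothOfRelativeDimension_morphismRestrict_of_forall`). This is the
scheme-theoretic content of "`φ = pr₂` is a submersion over the open set `U` of smooth hyperplane
sections" (Voisin II §3.2.2). [cite: VoisinHodgeII2003, §3.2.2] [cite: Hartshorne1977, III Prop. 10.4] -/
theorem exists_smoothOfRelativeDimension_morphismRestrict_of_fibre (n : ℕ)
    [SmoothOfRelativeDimension (n + 1) X.hom] [IsReduced X.left] [IsAffineHom ι.left] [IsProper X.hom]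
    (t : AlgPoints (dualProjectiveSpace N k) k)
    (hfib : SmoothOfRelativeDimension n (pullback.snd (proj N ι).left t.left)) :
    ∃ V₀ : (dualProjectiveSpace N k).left.Opens, t.pt ∈ V₀ ∧
      SmoothOfRelativeDimension n ((proj N ι).left ∣_ V₀) := by
  haveI : IsProper (proj N ι).left := isProper_proj_left N ι
  exact exists_smoothOfRelativeDimension_morphismRestrict_of_forall (proj N ι).left n
    (proj N ι).left.isClosedMap t.pt
    (fun x hx ↦ exists_smoothOfRelativeDimension_nhd_of_fibre ι n t hfib x hx)

end Assembly






end Literature.AlgebraicGeometry.Motives.UniversalHyperplaneSection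

end
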